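import Literature.NumberTheory.EllipticCurves.BinaryQuarticTwoCoveringsDescent
import Literature.NumberTheory.EllipticCurves.BinaryQuarticTwoCoveringsGlobalConic
import HarnessLib

/-!
# Two-coverings attached to binary quartic forms, XII: every `2`-Selmer class is the class of a
# locally soluble binary quartic form

Topic `Literature/NumberTheory/EllipticCurves`. Twelfth file of the theory proving the named fact
`Literature.NumberTheory.EllipticCurves.bhargavaShankar_card_selmerTwo_eq_kEquivClassCount`
(Bhargava–Shankar 2015, Lemma 5.2 / Theorem 3.5 of arXiv:1006.1002v2: "elements in the
`2`-Selmer group … are in bijective correspondence with … locally soluble binary quartic forms";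
Birch–Swinnerton-Dyer 1963, Lemma 1; Cremona 2001, §5). From the equivariant coordinate of file XI
(four values `ρ_t` with the root action `σ(ρ_t) = ρ_{κ_σ t ⊕ idx σ}`) we build the quartic with roots
`ρ_t`, normalise it by the Galois-fixed scalar `ν = Λ²·∏(e_k − x′)` so that its torsion abscissae
are exactly the `e_k` (`t = 1`), prove that its cocycle is `φ` on the nose, and clear denominators.

* `§1` `ν = Λ² D` is Galois-fixed and rational (`σ(D) = D a_σ²`);
* `§2` the monic quartic `ofRootVec 1 ρ` is coefficientwise Galois-fixed, hence rational (`gtil`);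
* `§3` its resolvent values `φ(ρ₀, ρ_k) = 3e_k/ν`; the normalised form `gsur = (−ν) • gtil` has
  `φ = −3e_k`, torsion abscissae `e_k`, and invariants `I = −3A`, `J = −27B` (`Setup … 1`);
* `§4` the cocycle of `gsur` at the root `ρ₀` is `φ`: `selmerClass = [φ]`;
* `§5` the class `0` is represented by the identity quartic; integral models; **surjectivity**
  `exists_selmerFormSet_of_mem`: every `c ∈ Sel₂(E_{A,B})` is `selmerClassOf f` for some
  `f ∈ selmerFormSet AB`.

## References

* M. Bhargava, A. Shankar, Ann. of Math. (2) 181 (2015), Lemma 5.2 and Thm. 3.5 (arXiv:1006.1002v2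
  numbering). [BhargavaShankarAnnals2015]
* B. J. Birch, H. P. F. Swinnerton-Dyer, *Notes on elliptic curves. I*, J. reine angew. Math. 212
  (1963), Lemma 1. [BirchSwinnertonDyer1963]
* J. E. Cremona, *Classical invariants and 2-descent on elliptic curves*, J. Symbolic Comput. 31
  (2001), §5. [Cremona2001]
-/

noncomputable section

open scoped Classical

universe u

namespace Literature.NumberTheory.EllipticCurves

namespace TwoCovering

open BinaryQuartic WeierstrassCurve WeierstrassCurve.Affine GaloisRepresentations
open Literature.NumberTheory.QuadraticForms NumberField IsDedekindDomain

/-! ## §1 The Galois-fixed scalar `ν = Λ² ∏ (e_k − x′)` -/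

section Nu

variable {AB : ℤ × ℤ} (hE : 4 * AB.1 ^ 3 + 27 * AB.2 ^ 2 ≠ 0)
  (φ : contOneCocycles (discreteTopRep (Field.absoluteGaloisGroup ℚ) (geomTorsion (shortWeierstrass AB) 2)))
  {x' : AlgebraicClosure ℚ} (hx : IsTwFixed hE φ x')

/-- `D = (e₁ − x′)(e₂ − x′)(e₃ − x′)` (`= −F(x′)`). [folklore] -/
def Dval (x' : AlgebraicClosure ℚ) : AlgebraicClosure ℚ := (eb hE 1 - x') * (eb hE 2 - x') * (eb hE 3 - x')

/-- **Permutation invariance of a product over `{1, 2, 3}`**. [folklore] -/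
theorem prod3_perm {R : Type*} [CommRing R] (Z : Fin 4 → R) {a b d : Fin 4} (ha : a ≠ 0) (hb : b ≠ 0) (hd : d ≠ 0)
    (hab : a ≠ b) (had : a ≠ d) (hbd : b ≠ d) : Z a * Z b * Z d = Z 1 * Z 2 * Z 3 := by
  have aux : ∀ j : Fin 4, j ≠ 0 → j = 1 ∨ j = 2 ∨ j = 3 := by decide
  rcases aux a ha with rfl | rfl | rfl <;> rcases aux b hb with rfl | rfl | rfl <;> rcases aux d hd with rfl | rfl | rfl <;>
    first
    | exact absurd rfl hab
    | exact absurd rfl had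
    | exact absurd rfl hbd
    | ring

include hx

/-- `D ≠ 0`. [folklore] -/
theorem Dval_ne_zero : Dval hE x' ≠ 0 := by
  have h := hx.1
  refine mul_ne_zero (mul_ne_zero ?_ ?_) ?_
  · exact fun h0 ↦ h 1 (by decide) (by linear_combination -h0)
  · exact fun h0 ↦ h 2 (by decide) (by linear_combination -h0)
  · exact fun h0 ↦ h 3 (by decide) (by linear_combination -h0)

/-- **`σ(D) = D · a_σ²`** (through `F(M_k X) = F′(e_k)² F(X)/(X − e_k)⁴`, here as the product of the
three translation differences). [folklore] -/
theorem gal_Dval (σ : Field.absoluteGaloisGroup ℚ) : gal σ (Dval hE x') = Dval hE x' * acoef hE φ x' σ ^ 2 := by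
  obtain ⟨hfixσ, hmovσ⟩ := hx.2 σ
  have hprod : gal σ (Dval hE x') = (eb hE (rootPerm hE σ 1) - gal σ x') * (eb hE (rootPerm hE σ 2) - gal σ x') *
      (eb hE (rootPerm hE σ 3) - gal σ x') := by
    simp only [Dval, map_mul, map_sub, gal_eb]
  -- reorder the factors back to `1, 2, 3`
  have hκ := fun j (hj : j ≠ 0) ↦ (rootPerm_ne_zero_iff hE σ j).mpr hj
  rw [hprod, prod3_perm (fun j ↦ eb hE j - gal σ x') (hκ 1 (by decide)) (hκ 2 (by decide)) (hκ 3 (by decide))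
    (fun h ↦ absurd ((rootPerm hE σ).injective h) (by decide)) (fun h ↦ absurd ((rootPerm hE σ).injective h) (by decide))
    (fun h ↦ absurd ((rootPerm hE σ).injective h) (by decide))]
  by_cases hk : idx hE φ σ = 0
  · rw [hfixσ hk, acoef, if_pos hk, one_pow, mul_one, Dval]
  · rw [hmovσ hk, acoef, if_neg hk]
    have hxk : x' - eb hE (idx hE φ σ) ≠ 0 := sub_ne_zero.mpr (hx.1 _ hk)
    -- the three differences `e_j − M_k(x′)` in the order `(k, l, m)`
    have hk' : idx hE φ σ = 1 ∨ idx hE φ σ = 2 ∨ idx hE φ σ = 3 := by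
      have : ∀ k : Fin 4, k ≠ 0 → k = 1 ∨ k = 2 ∨ k = 3 := by decide
      exact this _ hk
    -- generic computation for `k` and the other two indices `l`, `m = k ⊕ l`
    have key : ∀ {k l : Fin 4} (hk : k ≠ 0) (hl : l ≠ 0) (hkl : k ≠ l), x' - eb hE k ≠ 0 →
        (eb hE k - mobT (algebraMap ℚ (AlgebraicClosure ℚ) (AB.1 : ℚ)) (eb hE k) x') *
        (eb hE l - mobT (algebraMap ℚ (AlgebraicClosure ℚ) (AB.1 : ℚ)) (eb hE k) x') *
        (eb hE (v4add k l) - mobT (algebraMap ℚ (AlgebraicClosure ℚ) (AB.1 : ℚ)) (eb hE k) x') =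
        (eb hE k - x') * (eb hE l - x') * (eb hE (v4add k l) - x') *
          (-(3 * eb hE k ^ 2 + algebraMap ℚ (AlgebraicClosure ℚ) (AB.1 : ℚ)) / (x' - eb hE k) ^ 2) ^ 2 := by
      intro k l hk hl hkl hxk
      obtain ⟨hs, hA', hFk, -, -⟩ := deriv_factor_klm hE hk hl hkl
      obtain ⟨hm0, hmk, hml⟩ := v4add_ne hk hl hkl
      have h1 := mobT_sub_self (algebraMap ℚ (AlgebraicClosure ℚ) (AB.1 : ℚ)) (eb hE k) x' hxk
      have h2 := mobT_sub_other hxk hA'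
      rw [show x' + eb hE l + eb hE k = x' - eb hE (v4add k l) by linear_combination hs] at h2
      -- `M_k x′ − e_m`, from Vieta in the order `(k, m, l)`
      obtain ⟨hs', hA'', -, -, -⟩ := deriv_factor_klm hE hk hm0 hmk.symm
      have h3 := mobT_sub_other hxk hA''
      have aux2 : ∀ k l : Fin 4, v4add k (v4add k l) = l := by decide
      rw [aux2] at hs'
      rw [show x' + eb hE (v4add k l) + eb hE k = x' - eb hE l by linear_combination hs'] at h3
      rw [show eb hE k - mobT _ (eb hE k) x' = -(mobT _ (eb hE k) x' - eb hE k) by ring, h1,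
        show eb hE l - mobT _ (eb hE k) x' = -(mobT _ (eb hE k) x' - eb hE l) by ring, h2,
        show eb hE (v4add k l) - mobT _ (eb hE k) x' = -(mobT _ (eb hE k) x' - eb hE (v4add k l)) by ring, h3, hFk]
      field_simp
      ring
    rcases hk' with h1 | h2 | h3
    · rw [h1] at hxk ⊢
      have := key (k := 1) (l := 2) (by decide) (by decide) (by decide) hxk
      rw [show v4add (1 : Fin 4) 2 = 3 by decide] at this
      rw [this, Dval]
    · rw [h2] at hxk ⊢
      have := key (k := 2) (l := 1) (by decide) (by decide) (by decide) hxk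
      rw [show v4add (2 : Fin 4) 1 = 3 by decide] at this
      rw [show (eb hE 1 - mobT (algebraMap ℚ (AlgebraicClosure ℚ) (AB.1 : ℚ)) (eb hE 2) x') *
          (eb hE 2 - mobT (algebraMap ℚ (AlgebraicClosure ℚ) (AB.1 : ℚ)) (eb hE 2) x') *
          (eb hE 3 - mobT (algebraMap ℚ (AlgebraicClosure ℚ) (AB.1 : ℚ)) (eb hE 2) x') =
          (eb hE 2 - mobT (algebraMap ℚ (AlgebraicClosure ℚ) (AB.1 : ℚ)) (eb hE 2) x') *
          (eb hE 1 - mobT (algebraMap ℚ (AlgebraicClosure ℚ) (AB.1 : ℚ)) (eb hE 2) x') *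
          (eb hE 3 - mobT (algebraMap ℚ (AlgebraicClosure ℚ) (AB.1 : ℚ)) (eb hE 2) x') by ring, this, Dval]
      ring
    · rw [h3] at hxk ⊢
      have := key (k := 3) (l := 1) (by decide) (by decide) (by decide) hxk
      rw [show v4add (3 : Fin 4) 1 = 2 by decide] at this
      rw [show (eb hE 1 - mobT (algebraMap ℚ (AlgebraicClosure ℚ) (AB.1 : ℚ)) (eb hE 3) x') *
          (eb hE 2 - mobT (algebraMap ℚ (AlgebraicClosure ℚ) (AB.1 : ℚ)) (eb hE 3) x') *
          (eb hE 3 - mobT (algebraMap ℚ (AlgebraicClosure ℚ) (AB.1 : ℚ)) (eb hE 3) x') =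
          (eb hE 3 - mobT (algebraMap ℚ (AlgebraicClosure ℚ) (AB.1 : ℚ)) (eb hE 3) x') *
          (eb hE 1 - mobT (algebraMap ℚ (AlgebraicClosure ℚ) (AB.1 : ℚ)) (eb hE 3) x') *
          (eb hE 2 - mobT (algebraMap ℚ (AlgebraicClosure ℚ) (AB.1 : ℚ)) (eb hE 3) x') by ring, this, Dval]
      ring

/-- **`ν = Λ² D` over `ℚ̄`.** [folklore] -/
def nuC : AlgebraicClosure ℚ := Lam hE φ hx ^ 2 * Dval hE x'

/-- `ν ≠ 0`. [folklore] -/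
theorem nuC_ne_zero : nuC hE φ hx ≠ 0 := mul_ne_zero (pow_ne_zero _ (Lam_ne_zero hE φ hx)) (Dval_ne_zero hE φ hx)

/-- `ν` is Galois-fixed. [folklore] -/
theorem gal_nuC (σ : Field.absoluteGaloisGroup ℚ) : gal σ (nuC hE φ hx) = nuC hE φ hx := by
  rw [nuC, map_mul, map_pow, gal_Lam hE φ hx, gal_Dval hE φ hx]
  have ha := acoef_ne_zero hE φ hx σ
  field_simp

/-- **`ν` is rational.** [folklore] -/
theorem nuC_rational : ∃ q : ℚ, algebraMap ℚ (AlgebraicClosure ℚ) q = nuC hE φ hx :=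
  exists_algebraMap_eq_of_fixed ℚ _ (gal_nuC hE φ hx)

/-- The rational `ν`. [folklore] -/
def nuQ : ℚ := Classical.choose (nuC_rational hE φ hx)

/-- `ι(ν_ℚ) = ν`. [folklore] -/
theorem algebraMap_nuQ : algebraMap ℚ (AlgebraicClosure ℚ) (nuQ hE φ hx) = nuC hE φ hx :=
  Classical.choose_spec (nuC_rational hE φ hx)

/-- `ν_ℚ ≠ 0`. [folklore] -/
theorem nuQ_ne_zero : nuQ hE φ hx ≠ 0 := fun h ↦ nuC_ne_zero hE φ hx (by rw [← algebraMap_nuQ, h, map_zero])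

end Nu

/-! ## §2 The monic quartic with roots `ρ_t` is rational -/

section Gtil

variable {AB : ℤ × ℤ} (hE : 4 * AB.1 ^ 3 + 27 * AB.2 ^ 2 ≠ 0)
  (φ : contOneCocycles (discreteTopRep (Field.absoluteGaloisGroup ℚ) (geomTorsion (shortWeierstrass AB) 2)))
  {x' : AlgebraicClosure ℚ} (hx : IsTwFixed hE φ x')

omit hx in
/-- The root action of `σ` as a permutation of the four indices: `t ↦ κ_σ t ⊕ idx σ`. [folklore] -/
def rootActionPerm (σ : Field.absoluteGaloisGroup ℚ) : Equiv.Perm (Fin 4) where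
  toFun t := v4add (rootPerm hE σ t) (idx hE φ σ)
  invFun t := (rootPerm hE σ).symm (v4add t (idx hE φ σ))
  left_inv t := by
    have aux : ∀ a k : Fin 4, v4add (v4add a k) k = a := by decide
    simp only [aux, Equiv.symm_apply_apply]
  right_inv t := by
    have aux : ∀ a k : Fin 4, v4add (v4add a k) k = a := by decide
    simp only [Equiv.apply_symm_apply, aux]

include hx

/-- **The monic quartic `∏ (X − ρ_t Y)` is Galois-fixed.** [folklore] -/
theorem map_ofRootVec_rho (σ : Field.absoluteGaloisGroup ℚ) :
    (ofRootVec 1 (rho hE φ hx)).map ((gal σ : AlgebraicClosure ℚ →ₐ[ℚ] AlgebraicClosure ℚ) : AlgebraicClosure ℚ →+* _) =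
      ofRootVec 1 (rho hE φ hx) := by
  rw [map_ofRootVec]
  have h1 : ((gal σ : AlgebraicClosure ℚ →ₐ[ℚ] AlgebraicClosure ℚ) : AlgebraicClosure ℚ →+* AlgebraicClosure ℚ) 1 = 1 :=
    map_one _
  have hcomp : (((gal σ : AlgebraicClosure ℚ →ₐ[ℚ] AlgebraicClosure ℚ) : AlgebraicClosure ℚ →+* _) ∘ rho hE φ hx) =
      rho hE φ hx ∘ rootActionPerm hE φ σ := by
    funext t
    simp only [Function.comp_apply, AlgHom.coe_toRingHom, AlgEquiv.coe_toAlgHom]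
    exact gal_rho hE φ hx σ t
  rw [h1, hcomp, ofRootVec_comp_perm]

/-- Each coefficient of `∏ (X − ρ_t Y)` is rational. [folklore] -/
theorem exists_gtil : ∃ g : BinaryQuartic ℚ, g.map (algebraMap ℚ (AlgebraicClosure ℚ)) = ofRootVec 1 (rho hE φ hx) := by
  have hfix := map_ofRootVec_rho hE φ hx
  have hrat : ∀ z : AlgebraicClosure ℚ, (∀ σ : Field.absoluteGaloisGroup ℚ, gal σ z = z) →
      ∃ q : ℚ, algebraMap ℚ (AlgebraicClosure ℚ) q = z := fun z hz ↦ exists_algebraMap_eq_of_fixed ℚ z hz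
  obtain ⟨qa, ha⟩ := hrat (ofRootVec 1 (rho hE φ hx)).a fun σ ↦ by
    have h := congrArg BinaryQuartic.a (hfix σ); rw [map_a] at h; exact h
  obtain ⟨qb, hb⟩ := hrat (ofRootVec 1 (rho hE φ hx)).b fun σ ↦ by
    have h := congrArg BinaryQuartic.b (hfix σ); rw [map_b] at h; exact h
  obtain ⟨qc, hc⟩ := hrat (ofRootVec 1 (rho hE φ hx)).c fun σ ↦ by
    have h := congrArg BinaryQuartic.c (hfix σ); rw [map_c] at h; exact h
  obtain ⟨qd, hd⟩ := hrat (ofRootVec 1 (rho hE φ hx)).d fun σ ↦ by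
    have h := congrArg BinaryQuartic.d (hfix σ); rw [map_d] at h; exact h
  obtain ⟨qe, he⟩ := hrat (ofRootVec 1 (rho hE φ hx)).e fun σ ↦ by
    have h := congrArg BinaryQuartic.e (hfix σ); rw [map_e] at h; exact h
  exact ⟨⟨qa, qb, qc, qd, qe⟩, by ext <;> simp [BinaryQuartic.map, ha, hb, hc, hd, he]⟩

/-- **The rational monic quartic `g̃`** with `g̃ ⊗ ℚ̄ = ∏ (X − ρ_t Y)`. [folklore] -/
def gtil : BinaryQuartic ℚ := Classical.choose (exists_gtil hE φ hx)

/-- `g̃ ⊗ ℚ̄ = ofRootVec 1 ρ`. [folklore] -/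
theorem map_gtil : (gtil hE φ hx).map (algebraMap ℚ (AlgebraicClosure ℚ)) = ofRootVec 1 (rho hE φ hx) :=
  Classical.choose_spec (exists_gtil hE φ hx)

/-- `g̃` is monic. [folklore] -/
theorem gtil_a : (gtil hE φ hx).a = 1 := by
  have h := congrArg BinaryQuartic.a (map_gtil hE φ hx)
  simp only [map_a, ofRootVec, ofRoots] at h
  exact (algebraMap ℚ (AlgebraicClosure ℚ)).injective (by rw [h, map_one])

end Gtil

/-! ## §3 Resolvent values and the normalised form -/

section Gsur

variable {AB : ℤ × ℤ} (hE : 4 * AB.1 ^ 3 + 27 * AB.2 ^ 2 ≠ 0)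
  (φ : contOneCocycles (discreteTopRep (Field.absoluteGaloisGroup ℚ) (geomTorsion (shortWeierstrass AB) 2)))
  {x' : AlgebraicClosure ℚ} (hx : IsTwFixed hE φ x')
include hx

omit hx in
/-- The cross-term identity behind `φ(ρ₀, ρ_k)`. [folklore] -/
theorem phi_aux {F : Type*} [Field F] (L b d₁ d₂ d₃ : F) (hL : L ≠ 0) (h₁ : d₁ ≠ 0) (h₂ : d₂ ≠ 0) (h₃ : d₃ ≠ 0) :
    (b - ((L * d₂)⁻¹ + b)) * (((L * d₁)⁻¹ + b) - ((L * d₃)⁻¹ + b)) +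
      (b - ((L * d₃)⁻¹ + b)) * (((L * d₁)⁻¹ + b) - ((L * d₂)⁻¹ + b)) = (2 * d₁ - d₂ - d₃) / (L ^ 2 * (d₁ * d₂ * d₃)) := by
  field_simp
  ring

/-- **The resolvent values of `∏ (X − ρ_t Y)`**: `φ(ρ₀, ρ_k) = 3 e_k / ν` for `k = 1, 2, 3`
(root differences `ρ_k − ρ₀ = 1/(Λ(e_k − x′))` and `e₁ + e₂ + e₃ = 0`). [folklore] -/
theorem phi_rho {k : Fin 4} (hk : k ≠ 0) :
    phi (ofRootVec 1 (rho hE φ hx)) (rho hE φ hx 0) (rho hE φ hx k) = 3 * eb hE k / nuC hE φ hx := by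
  obtain ⟨hs, -, -⟩ := eb_vieta hE
  have hL := Lam_ne_zero hE φ hx
  have hd : ∀ j : Fin 4, j ≠ 0 → eb hE j - x' ≠ 0 := fun j hj h ↦ hx.1 j hj (by linear_combination -h)
  have h1 := hd 1 (by decide)
  have h2 := hd 2 (by decide)
  have h3 := hd 3 (by decide)
  have key : ∀ (r : Fin 4 → AlgebraicClosure ℚ), phi (ofRootVec 1 r) (r 0) (r 1) =
      (r 0 - r 2) * (r 1 - r 3) + (r 0 - r 3) * (r 1 - r 2) := fun r ↦ by
    rw [phi_ofRootVec_eq_diff, one_mul]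
  have hk' : k = 1 ∨ k = 2 ∨ k = 3 := by
    have : ∀ k : Fin 4, k ≠ 0 → k = 1 ∨ k = 2 ∨ k = 3 := by decide
    exact this _ hk
  rw [nuC, Dval]
  rcases hk' with rfl | rfl | rfl
  · rw [key, rho_zero, rho_of_ne hE φ hx (t := 1) (by decide), rho_of_ne hE φ hx (t := 2) (by decide),
      rho_of_ne hE φ hx (t := 3) (by decide), phi_aux _ _ _ _ _ hL h1 h2 h3,
      show 2 * (eb hE 1 - x') - (eb hE 2 - x') - (eb hE 3 - x') = 3 * eb hE 1 by linear_combination -hs]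
  · have hperm := ofRootVec_comp_perm (1 : AlgebraicClosure ℚ) (rho hE φ hx) (Equiv.swap 1 2)
    rw [← hperm, show rho hE φ hx 0 = (rho hE φ hx ∘ Equiv.swap 1 2) 0 from rfl,
      show rho hE φ hx 2 = (rho hE φ hx ∘ Equiv.swap 1 2) 1 from rfl, key]
    simp only [Function.comp_apply, Equiv.swap_apply_left, Equiv.swap_apply_right,
      show Equiv.swap (1 : Fin 4) 2 0 = 0 by decide, show Equiv.swap (1 : Fin 4) 2 3 = 3 by decide]
    rw [rho_zero, rho_of_ne hE φ hx (t := 1) (by decide), rho_of_ne hE φ hx (t := 2) (by decide),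
      rho_of_ne hE φ hx (t := 3) (by decide), phi_aux _ _ _ _ _ hL h2 h1 h3,
      show 2 * (eb hE 2 - x') - (eb hE 1 - x') - (eb hE 3 - x') = 3 * eb hE 2 by linear_combination -hs,
      show Lam hE φ hx ^ 2 * ((eb hE 2 - x') * (eb hE 1 - x') * (eb hE 3 - x')) =
        Lam hE φ hx ^ 2 * ((eb hE 1 - x') * (eb hE 2 - x') * (eb hE 3 - x')) by ring]
  · have hperm := ofRootVec_comp_perm (1 : AlgebraicClosure ℚ) (rho hE φ hx) (Equiv.swap 1 3)
    rw [← hperm, show rho hE φ hx 0 = (rho hE φ hx ∘ Equiv.swap 1 3) 0 from rfl,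
      show rho hE φ hx 3 = (rho hE φ hx ∘ Equiv.swap 1 3) 1 from rfl, key]
    simp only [Function.comp_apply, Equiv.swap_apply_left, Equiv.swap_apply_right,
      show Equiv.swap (1 : Fin 4) 3 0 = 0 by decide, show Equiv.swap (1 : Fin 4) 3 2 = 2 by decide]
    rw [rho_zero, rho_of_ne hE φ hx (t := 1) (by decide), rho_of_ne hE φ hx (t := 2) (by decide),
      rho_of_ne hE φ hx (t := 3) (by decide), phi_aux _ _ _ _ _ hL h3 h2 h1,
      show 2 * (eb hE 3 - x') - (eb hE 2 - x') - (eb hE 1 - x') = 3 * eb hE 3 by linear_combination -hs,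
      show Lam hE φ hx ^ 2 * ((eb hE 3 - x') * (eb hE 2 - x') * (eb hE 1 - x')) =
        Lam hE φ hx ^ 2 * ((eb hE 1 - x') * (eb hE 2 - x') * (eb hE 3 - x')) by ring]

omit hx in
/-- `(c • f) ⊗ = c • (f ⊗)`. [folklore] -/
theorem map_smul_form {R S : Type*} [CommRing R] [CommRing S] (ψ : R →+* S) (c : R) (f : BinaryQuartic R) :
    (c • f).map ψ = ψ c • f.map ψ := by
  ext <;> simp [BinaryQuartic.map]

/-- **The normalised form** `g = (−ν) • g̃` (rational, leading coefficient `−ν`). [folklore] -/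
def gsur : BinaryQuartic ℚ := (-nuQ hE φ hx) • gtil hE φ hx

/-- `g ⊗ ℚ̄ = ofRootVec (−ν) ρ`. [folklore] -/
theorem map_gsur : (gsur hE φ hx).map (algebraMap ℚ (AlgebraicClosure ℚ)) = ofRootVec (-nuC hE φ hx) (rho hE φ hx) := by
  rw [gsur, map_smul_form, map_gtil, map_neg, algebraMap_nuQ, ← ofRootVec_mul, mul_one]

/-- `g.a = −ν_ℚ ≠ 0`. [folklore] -/
theorem gsur_a : (gsur hE φ hx).a = -nuQ hE φ hx := by
  rw [gsur, smul_a, gtil_a, mul_one]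

/-- Root data for `g ⊗ ℚ̄`: the `ρ_t`. [folklore] -/
def rootDataGsur : RootData ((gsur hE φ hx).map (algebraMap ℚ (AlgebraicClosure ℚ))) where
  r := rho hE φ hx
  eq_ofRoots := by
    rw [map_a, gsur_a, map_neg, algebraMap_nuQ, map_gsur]

/-- The resolvent values of `g ⊗ ℚ̄`: `φ(ρ₀, ρ_k) = −3 e_k`. [folklore] -/
theorem phi_gsur {k : Fin 4} (hk : k ≠ 0) :
    phi ((gsur hE φ hx).map (algebraMap ℚ (AlgebraicClosure ℚ))) (rho hE φ hx 0) (rho hE φ hx k) = -3 * eb hE k := by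
  rw [map_gsur, show ofRootVec (-nuC hE φ hx) (rho hE φ hx) = ofRootVec (-nuC hE φ hx * 1) (rho hE φ hx) by rw [mul_one],
    ofRootVec_mul, phi_smul, phi_rho hE φ hx hk]
  have hν := nuC_ne_zero hE φ hx
  field_simp

/-- **The torsion abscissae of `g` are the `e_k`** (`t = 1`). [folklore] -/
theorem torsX_gsur {k : Fin 4} (hk : k ≠ 0) :
    torsX ((gsur hE φ hx).map (algebraMap ℚ (AlgebraicClosure ℚ))) 1 (rho hE φ hx 0) (rho hE φ hx k) = eb hE k := by
  rw [torsX, phi_gsur hE φ hx hk]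
  have h3 : (3 : AlgebraicClosure ℚ) ≠ 0 := by norm_num
  field_simp

/-- **The invariants of `g`**: `I(g) = −3A`, `J(g) = −27B` (from the resolvent `∏ (X + 3e_k)` and
Vieta). [folklore] -/
theorem invariants_gsur : (gsur hE φ hx).I = -3 * (AB.1 : ℚ) ∧ (gsur hE φ hx).J = -27 * (AB.2 : ℚ) := by
  obtain ⟨hs, hA, hB⟩ := eb_vieta hE
  have hres := fun X ↦ resolvent_eq_ofRoots (-nuC hE φ hx) (rho hE φ hx) X
  have hφ : ∀ {k : Fin 4}, k ≠ 0 → phi (ofRootVec (-nuC hE φ hx) (rho hE φ hx)) (rho hE φ hx 0) (rho hE φ hx k) =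
      -3 * eb hE k := fun hk ↦ by rw [← map_gsur]; exact phi_gsur hE φ hx hk
  rw [hφ (k := 1) (by decide), hφ (k := 2) (by decide), hφ (k := 3) (by decide), ← map_gsur, I_map, J_map] at hres
  have h0 := hres 0
  have h1 := hres 1
  have hJ : algebraMap ℚ (AlgebraicClosure ℚ) (gsur hE φ hx).J = -27 * algebraMap ℚ (AlgebraicClosure ℚ) (AB.2 : ℚ) := by
    linear_combination -h0 + 27 * hB
  have hI : algebraMap ℚ (AlgebraicClosure ℚ) (gsur hE φ hx).I = -3 * algebraMap ℚ (AlgebraicClosure ℚ) (AB.1 : ℚ) := by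
    linear_combination (1 / 3 : AlgebraicClosure ℚ) * h1 - hs - 3 * hA - (1 / 3 : AlgebraicClosure ℚ) * h0
  constructor
  · apply (algebraMap ℚ (AlgebraicClosure ℚ)).injective
    rw [hI, map_mul, map_neg, map_ofNat]
  · apply (algebraMap ℚ (AlgebraicClosure ℚ)).injective
    rw [hJ, map_mul, map_neg, map_ofNat]

/-- **`g` is in the `E_{A,B}`-family with `t = 1`.** [folklore] -/
theorem setup_gsur : Setup (gsur hE φ hx) (AB.1 : ℚ) (AB.2 : ℚ) 1 where
  a_ne := by rw [gsur_a]; exact neg_ne_zero.mpr (nuQ_ne_zero hE φ hx)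
  t_ne := one_ne_zero
  I_eq := by rw [(invariants_gsur hE φ hx).1]; ring
  J_eq := by rw [(invariants_gsur hE φ hx).2]; ring
  disc_ne := by exact_mod_cast hE

end Gsur

/-! ## §4 The class of `g` is `[φ]` -/

section ClassEq

/-- Congruence of torsor differences across forms: equal torsion abscissae and matching
(in)equality of the arguments. [folklore] -/
theorem torsorPt_congr'' {F : Type*} [Field F] {C : Affine F} {f f' : BinaryQuartic F} {t t' u v u' v' : F}
    (hx : torsX f t u v = torsX f' t' u' v') (hne : u ≠ v ↔ u' ≠ v') :
    torsorPt C f t u v = torsorPt C f' t' u' v' := by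
  by_cases h : u ≠ v ∧ C.Nonsingular (torsX f t u v) 0
  · have h' : u' ≠ v' ∧ C.Nonsingular (torsX f' t' u' v') 0 := ⟨hne.mp h.1, hx ▸ h.2⟩
    rw [torsorPt, dif_pos h, torsorPt, dif_pos h']
    simp only [Point.some.injEq, and_true]
    exact hx
  · have h' : ¬(u' ≠ v' ∧ C.Nonsingular (torsX f' t' u' v') 0) := fun h' ↦ h ⟨hne.mpr h'.1, hx.symm ▸ h'.2⟩
    rw [torsorPt, dif_neg h, torsorPt, dif_neg h']

variable {AB : ℤ × ℤ} (hE : 4 * AB.1 ^ 3 + 27 * AB.2 ^ 2 ≠ 0)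
  (φ : contOneCocycles (discreteTopRep (Field.absoluteGaloisGroup ℚ) (geomTorsion (shortWeierstrass AB) 2)))
  {x' : AlgebraicClosure ℚ} (hx : IsTwFixed hE φ x')
include hx

/-- `ρ₀` is a root of `g`. [folklore] -/
theorem eval_rho_zero : ((gsur hE φ hx).map (algebraMap ℚ (AlgebraicClosure ℚ))).eval (rho hE φ hx 0) 1 = 0 :=
  (rootDataGsur hE φ hx).eval_r 0

/-- **The torsor differences of `g` are the bootstrap torsors**: `T_g(ρ₀, ρ_k) = Tb k`. [folklore] -/
theorem torsorPt_gsur (k : Fin 4) :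
    torsorPt ((shortWeierstrass AB).baseChange (AlgebraicClosure ℚ)).toAffine
      ((gsur hE φ hx).map (algebraMap ℚ (AlgebraicClosure ℚ))) (algebraMap ℚ (AlgebraicClosure ℚ) 1)
      (rho hE φ hx 0) (rho hE φ hx k) = (Tb hE k : ((shortWeierstrass AB).baseChange (AlgebraicClosure ℚ)).toAffine.Point) := by
  by_cases hk : k = 0
  · rw [hk, torsorPt_self, Tb_zero]; rfl
  · rw [Tb_eq]
    refine torsorPt_congr'' ?_ ⟨fun _ h ↦ hk (bootData_injective hE h).symm, fun _ h ↦ hk (rho_injective hE φ hx h).symm⟩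
    rw [map_one, torsX_gsur hE φ hx hk]
    rfl

/-- **The Selmer class of `g` is `[φ]`**: its cocycle at the root `ρ₀` is `φ` on the nose
(`σρ₀ = ρ_{idx σ}` by the root action). [cite: BirchSwinnertonDyer1963, Lemma 1 (every Selmer element is represented by a quartic)] -/
theorem selmerClass_gsur : selmerClass (setup_gsur hE φ hx) (eval_rho_zero hE φ hx) = oneCocycleClass _ φ := by
  show oneCocycleClass _ (selmerCocycle _ _) = oneCocycleClass _ φ
  congr 1
  refine Subtype.ext (ContinuousMap.ext fun σ ↦ Subtype.ext ?_)
  rw [selmerCocycle_apply, geomCocycleFun_eq_geomTorsorPt, geomTorsorPt_eq, idx_spec hE φ σ]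
  have hσ : (show AlgebraicClosure ℚ ≃ₐ[ℚ] AlgebraicClosure ℚ from σ) (rho hE φ hx 0) = rho hE φ hx (idx hE φ σ) := by
    have h := gal_rho hE φ hx σ 0
    rw [rootPerm_zero, zero_v4add] at h
    exact h
  rw [hσ]
  exact torsorPt_gsur hE φ hx _

end ClassEq

/-! ## §5 Surjectivity -/

section Surjective

variable {AB : ℤ × ℤ}

/-- **The identity quartic lies in `selmerFormSet`** (`t = 2`; locally soluble by the tree's
`isLocallySoluble_identityQuartic`). [folklore] -/
theorem identityForm_mem : identityForm AB ∈ selmerFormSet AB := by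
  refine ⟨⟨⟨1, 0, 0, Or.inl one_ne_zero, by simp [identityForm, BinaryQuartic.eval, BinaryQuartic.map]⟩,
    fun p _ ↦ ⟨1, 0, 0, Or.inl one_ne_zero, by simp [identityForm, BinaryQuartic.eval, BinaryQuartic.map]⟩⟩,
    2, two_ne_zero, ?_, ?_⟩
  · rw [(invariants_identityForm AB).1]; push_cast; ring
  · rw [(invariants_identityForm AB).2]; push_cast; ring

/-- **The bootstrap form has trivial Selmer class**: its cocycle at the rational root vanishes.
[folklore] -/
theorem selmerClass_bootForm_eq_zero (hE : 4 * AB.1 ^ 3 + 27 * AB.2 ^ 2 ≠ 0) {t : ℚ} (h : Setup (bootForm AB) (AB.1 : ℚ) (AB.2 : ℚ) t)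
    {r : AlgebraicClosure ℚ} (hr : ((bootForm AB).map (algebraMap ℚ (AlgebraicClosure ℚ))).eval r 1 = 0) :
    selmerClass h hr = 0 := by
  have hboot : ((bootForm AB).map (algebraMap ℚ (AlgebraicClosure ℚ))).eval (algebraMap ℚ _ (bootRoot AB)) 1 = 0 := by
    rw [show (1 : AlgebraicClosure ℚ) = algebraMap ℚ _ 1 from (map_one _).symm, eval_map, eval_bootRoot hE, map_zero]
  rw [selmerClass_changeRoot h hboot hr]
  show oneCocycleClass _ (selmerCocycle _ _) = 0
  refine (oneCocycleClass_eq_zero_iff _ _).mpr ⟨0, fun σ ↦ Subtype.ext ?_⟩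
  rw [selmerCocycle_apply, geomCocycleFun_eq_geomTorsorPt, geomTorsorPt_eq, AlgEquiv.commutes, torsorPt_self, map_zero,
    sub_zero]
  rfl

/-- `selmerClassOf (identityForm) = 0`. [folklore] -/
theorem selmerClassOf_identityForm (hE : 4 * AB.1 ^ 3 + 27 * AB.2 ^ 2 ≠ 0) : selmerClassOf (identityForm_mem (AB := AB)) hE = 0 :=
  selmerClass_bootForm_eq_zero hE _ _

/-- **Integral models**: every rational form has an integral model up to a square scalar:
`f ⊗ ℚ = N² • g` for some `N ∈ ℕ`, `N ≠ 0`. [folklore] -/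
theorem exists_intModel (g : BinaryQuartic ℚ) :
    ∃ (N : ℕ) (f : BinaryQuartic ℤ), N ≠ 0 ∧ f.map (Int.castRingHom ℚ) = ((N : ℚ) ^ 2) • g := by
  set N : ℕ := g.a.den * g.b.den * g.c.den * g.d.den * g.e.den with hN
  have hNpos : N ≠ 0 := by
    simp only [hN]; exact Nat.mul_ne_zero (Nat.mul_ne_zero (Nat.mul_ne_zero (Nat.mul_ne_zero g.a.den_nz g.b.den_nz) g.c.den_nz)
      g.d.den_nz) g.e.den_nz
  have key : ∀ q : ℚ, q.den ∣ N → ∃ z : ℤ, (z : ℚ) = (N : ℚ) ^ 2 * q := by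
    intro q hq
    obtain ⟨c, hc⟩ := hq
    refine ⟨q.num * c * (q.den * c), ?_⟩
    have hq' := Rat.num_div_den q
    have hden : (q.den : ℚ) ≠ 0 := by exact_mod_cast q.den_nz
    have hnum : (q.num : ℚ) = q * q.den := by rw [← (div_eq_iff hden).mp hq']
    rw [hc]
    push_cast
    rw [hnum]
    ring
  obtain ⟨za, ha⟩ := key g.a ⟨g.b.den * g.c.den * g.d.den * g.e.den, by rw [hN]; ring⟩
  obtain ⟨zb, hb⟩ := key g.b ⟨g.a.den * g.c.den * g.d.den * g.e.den, by rw [hN]; ring⟩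
  obtain ⟨zc, hc⟩ := key g.c ⟨g.a.den * g.b.den * g.d.den * g.e.den, by rw [hN]; ring⟩
  obtain ⟨zd, hd⟩ := key g.d ⟨g.a.den * g.b.den * g.c.den * g.e.den, by rw [hN]; ring⟩
  obtain ⟨ze, he⟩ := key g.e ⟨g.a.den * g.b.den * g.c.den * g.d.den, by rw [hN]; ring⟩
  exact ⟨N, ⟨za, zb, zc, zd, ze⟩, hNpos, by ext <;> simp [BinaryQuartic.map, ha, hb, hc, hd, he]⟩

/-- **Surjectivity of the Selmer map** (Bhargava–Shankar, Lemma 5.2 / Thm. 3.5; Birch–Swinnerton-Dyer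
1963, Lemma 1; Cremona 2001, §5): every class in `Sel₂(E_{A,B}/ℚ)` is the Selmer class of a locally
soluble integral binary quartic form with invariants `t⁴(−3A)`, `t⁶(−27B)`.
[cite: BhargavaShankarAnnals2015, Lemma 5.2 and Thm. 3.5 (arXiv:1006.1002v2 numbering)] -/
theorem exists_selmerFormSet_of_mem (hE : 4 * AB.1 ^ 3 + 27 * AB.2 ^ 2 ≠ 0)
    {c : galH1Torsion (shortWeierstrass AB) 2} (hc : c ∈ selmerGroup (shortWeierstrass AB) 2) :
    ∃ (f : BinaryQuartic ℤ) (hf : f ∈ selmerFormSet AB), selmerClassOf hf hE = c := by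
  obtain ⟨φ, rfl⟩ := oneCocycleClass_surjective _ c
  obtain ⟨v, hv0, hvq⟩ := exists_rat_isotropic hE φ hc
  rcases exists_twFixed hE φ v hv0 hvq with h0 | ⟨x', hx⟩
  · exact ⟨identityForm AB, identityForm_mem, by rw [h0]; exact selmerClassOf_identityForm hE⟩
  · obtain ⟨N, f, hN, hf⟩ := exists_intModel (gsur hE φ hx)
    have hN' : (N : ℚ) ≠ 0 := by exact_mod_cast hN
    have hsetup := setup_gsur hE φ hx
    -- the scaled form `N² • g`
    have hsetup2 : Setup (((N : ℚ) ^ 2) • gsur hE φ hx) (AB.1 : ℚ) (AB.2 : ℚ) (N : ℚ) :=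
      { a_ne := by rw [smul_a]; exact mul_ne_zero (pow_ne_zero _ hN') hsetup.a_ne
        t_ne := hN'
        I_eq := by rw [I_smul, hsetup.I_eq]; ring
        J_eq := by rw [J_smul, hsetup.J_eq]; ring
        disc_ne := hsetup.disc_ne }
    have hroot2 : ((((N : ℚ) ^ 2) • gsur hE φ hx).map (algebraMap ℚ (AlgebraicClosure ℚ))).eval (rho hE φ hx 0) 1 = 0 := by
      rw [map_smul_form, eval_smul, eval_rho_zero hE φ hx, mul_zero]
    have hclass2 : selmerClass hsetup2 hroot2 = oneCocycleClass _ φ := by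
      rw [← selmerClass_gsur hE φ hx]
      exact selmerClass_eq_of_kEquiv hsetup hsetup2 hN' (γ := 1) (by simp) (by rw [subst_one]) (eval_rho_zero hE φ hx) hroot2
    -- `f` is locally soluble and lies in `selmerFormSet`
    have hls : f.IsLocallySoluble :=
      (selmerClass_mem_selmerGroup_iff hsetup2 hroot2 hf.symm (GL2ZEquiv.refl f)).mp (hclass2 ▸ hc)
    have hfmem : f ∈ selmerFormSet AB := by
      refine ⟨hls, N, hN', ?_, ?_⟩
      · have h := congrArg BinaryQuartic.I hf
        rw [I_map, hsetup2.I_eq] at h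
        rw [show ((f.I : ℚ)) = (Int.castRingHom ℚ) f.I from rfl, h]; ring
      · have h := congrArg BinaryQuartic.J hf
        rw [J_map, hsetup2.J_eq] at h
        rw [show ((f.J : ℚ)) = (Int.castRingHom ℚ) f.J from rfl, h]; ring
    refine ⟨f, hfmem, ?_⟩
    rw [← hclass2]
    show selmerClass (setup_normRep hfmem hE) (eval_rootOf hfmem hE) = _
    have hrep : normRep f = (1 : ℚ) ^ 2 • (((N : ℚ) ^ 2) • gsur hE φ hx).subst
        ((shearMatrix (normShift f)).map (Int.castRingHom ℚ)) := by
      rw [normRep_eq_smul_subst, hf]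
    have hdet : ((shearMatrix (normShift f)).map (Int.castRingHom ℚ)).det ≠ 0 := by
      rw [show (shearMatrix (normShift f)).map (Int.castRingHom ℚ) = (Int.castRingHom ℚ).mapMatrix (shearMatrix (normShift f))
        from rfl, ← RingHom.map_det, det_shearMatrix, map_one]
      exact one_ne_zero
    exact selmerClass_eq_of_kEquiv hsetup2 (setup_normRep hfmem hE) one_ne_zero hdet hrep hroot2 (eval_rootOf hfmem hE)

end Surjective

end TwoCovering

end Literature.NumberTheory.EllipticCurves
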